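import Summits.BirchSwinnertonDyer.BirchSwinnertonDyer.Theorems.SchneiderFreeAdditiveX3LocalTowerTorsionFiniteX3F
import Literature.NumberTheory.EllipticCurves.AnticyclotomicLocalNormResidueSymbolProofs
import HarnessLib

/-!
# Crux r5 `LocalTowerTorsionFiniteX3` (stmt-BirchSwinnertonDyer-19546) CLOSED — Fin_v on every cell of
# the K1 door, FACT-FREE (route `SchneiderFreeAdditiveX3`, seat `bsd-schneider-door-c4` gen 6)

`LocalTowerTorsionFiniteX3`: for every `W` in B6 ∩ X3 ∩ sst-twist with `r_an = 1` and odd `p`, at every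
imaginary quadratic `K` with `p` split, every anticyclotomic `ℤ_p`-extension `κ` and every `𝔭 ∣ p`, the
`p`-primary torsion of `E` over the completed anticyclotomic tower, `E(K̄)[p^∞]^{D_𝔭 ⊓ ker κ}`, is
FINITE (Jetchev–Skinner–Wan 2017 Prop. 3.3.4 Case 3(b), input `T^∨_{P_v}` finite, at an ADDITIVE `p`).
The F-record `LocalTowerTorsionFiniteX3F` (item 19668, door-c6 g3 `localTowerTorsionFiniteX3F_proof`,
p460069) is this statement under the ONE cite-only class-field-theoretic antecedent
`ZpExtension.exists_isFrobPow_mem_kerSubgroup_of_isAnticyclotomic` (the local norm residue symbol of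
`π/π̄` at a split prime fixes the anticyclotomic tower, with Frobenius degree `h` and cyclotomic
character `p^{2h}/π²`); that antecedent is now a tree THEOREM
(`ZpExtension.exists_isFrobPow_mem_kerSubgroup_of_isAnticyclotomic_holds`,
`Literature/NumberTheory/EllipticCurves/AnticyclotomicLocalNormResidueSymbolProofs.lean`: Tate VII §6
local–global compatibility + Artin reciprocity + Serre's Theorem 2 + the pro-dihedral symmetry), so
the fact-free item closes by name.  A record of the control corner, off the leaf's critical path
(p447721); closing it does not advance BSD beyond the typed reduction.  Proof only; no definition, no
named fact, no `sorry`.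
-/

namespace Summit.BirchSwinnertonDyer.BirchSwinnertonDyer.Theorems.SchneiderFreeAdditiveX3

set_option linter.dupNamespace false

/-- **Item stmt-BirchSwinnertonDyer-19546 `LocalTowerTorsionFiniteX3` (crux r5, Fin_v), proved
unconditionally**: `localTowerTorsionFiniteX3F_proof` (F-record 19668) applied to the tree theorem
`ZpExtension.exists_isFrobPow_mem_kerSubgroup_of_isAnticyclotomic_holds`.
[cite: JetchevSkinnerWan2017, §3.3 Prop. 3.3.4 Case 3(b), Remark 3.3.5 (arXiv:1512.06894 p. 13)]
[cite: CasselsFrohlichANT1967, Ch. VII §6 Prop. 6.2; Ch. VI §3.1 Thm. 2] -/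
theorem localTowerTorsionFiniteX3_proof :
    Summit.BirchSwinnertonDyer.BirchSwinnertonDyer.Theses.SchneiderFreeAdditiveX3.LocalTowerTorsionFiniteX3 :=
  localTowerTorsionFiniteX3F_proof fun K _ _ p _ =>
    Literature.NumberTheory.EllipticCurves.ZpExtension.exists_isFrobPow_mem_kerSubgroup_of_isAnticyclotomic_holds K p

end Summit.BirchSwinnertonDyer.BirchSwinnertonDyer.Theorems.SchneiderFreeAdditiveX3
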